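import Summits.ValiantsHypothesis.ValiantsHypothesis.Theorems.LacunarySymmetroidMatrixDescartesCensusPivotResolventDescartes

/-!
# `MatrixDescartes` census — pivot column: the INDEX-GRADED DESCARTES BOUND (every format, every index);
# «index two is free»

HONEST FRAMING.  Cell `pub-symmetroid`, seat `val-sym-mdr-p2` (gen 26); helper file `--supports` the crux
`Theses.LacunarySymmetroid.MatrixDescartes` (OPEN), NO closure claim.  Pivot currency of `…CensusPivotDefs`.  The tree's resolvent row
`Pivot.rankOneResolventDescartes_holds` (gen 3: index `≤ 1 ⇒ Z₊ ≤ 2·C(K+m−1, m−1)`) is the case `q = 1` of a GRADED count in the signed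
Gram (Cauchy–Binet) expansion `…CensusPivotGramExpansion`: with `J + WWᵀ = S₀S₀ᵀ` (`W` real `m × q`) and `Pₖ = SₖSₖᵀ` the determinant is
a sum of SQUARES over `m`-subsets of the column pool, signed by `(−1)^{#columns of W used}`; a negative coefficient sits on an exponent
`j·e + (m − j letter exponents)` with `j` ODD, `j ≤ q`, and the negative-support budget `Pivot.TwoDescartes.card_posRoots_le_two_mul_card`
bounds `Z₊` by twice the number of such exponents.
* `pencil_eq_gram` (the Gram form with `q` negative columns), **`pivotRootLawAt_indexGraded`**:
  `PivotRootLawAt m K q (2 · ∑_{j odd, j ≤ min q m} C(K+m−j, K))` for all `m, K, q`;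
* **`pivotRootLawAt_two_index`** («INDEX TWO IS FREE»): `PivotRootLawAt m K 2 (2·C(K+m−1, m−1))`, the index-one budget;
* companion `…PivotDefiniteGraded`: the sharper count for a NEGATIVE-SEMIDEFINITE pivot (positive part absent), the `2K` law of
  `Pivot.DefinitePivot…` at every size, and the four-letter column with `J ⪯ 0` at `n = 3` (`≤ 14`).
These graded rows beat the count-vector ceiling only for thin formats or small `n`; nothing here bears on `MatrixDescartes` in its window,
on `stub_twoSided`, on `DoorA26` / `DoorA34`, on the cell's registers, or on `VP ≠ VNP`.

[folklore] Cauchy–Binet (tree `Pivot.GramExpansion.coeff_det_gramPencil`), the Gram form of `Pivot.ResolventDescartes` with `q` negative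
columns, the negative-support budget.  No definitions, no named facts.
-/

-- `Summit.ValiantsHypothesis.ValiantsHypothesis.…` repeats a component by the single-conjunct
-- summit layout, which the `dupNamespace` linter flags; the name is mandated.
set_option linter.dupNamespace false

namespace Summit.ValiantsHypothesis.ValiantsHypothesis.Theorems.LacunarySymmetroidMatrixDescartes.Pivot

open Polynomial Matrix Finset
open scoped BigOperators MatrixOrder

namespace IndexGraded

variable {m K q : ℕ}

/-! ### 1. The Gram form with `q` negative columns -/

/-- Column pool `σ = (letters × columns) ⊕ (negative columns)`: the pivot pencil `X^e J + ∑ X^{dₖ} Pₖ` with `J + WWᵀ = S₀S₀ᵀ`,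
`Pₖ = SₖSₖᵀ` is the signed Gram pencil of the columns of `S₀` (exponent `e`, sign `+`), of the `Sₖ` (exponent `dₖ`, sign `+`) and of
`W` (exponent `e`, sign `−`). [folklore] -/
theorem pencil_eq_gram (e : ℕ) (d : Fin K → ℕ) (J : Matrix (Fin m) (Fin m) ℝ) (P : Fin K → Matrix (Fin m) (Fin m) ℝ)
    (W : Matrix (Fin m) (Fin q) ℝ) (S₀ : Matrix (Fin m) (Fin m) ℝ) (S : Fin K → Matrix (Fin m) (Fin m) ℝ)
    (hS₀ : J + W * Wᵀ = S₀ * S₀ᵀ) (hS : ∀ k, P k = S k * (S k)ᵀ)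
    (ε : ((Option (Fin K) × Fin m) ⊕ Fin q) ≃ Fin (Fintype.card ((Option (Fin K) × Fin m) ⊕ Fin q))) :
    ((X : ℝ[X]) ^ e) • J.map Polynomial.C + ∑ k, ((X : ℝ[X]) ^ d k) • (P k).map Polynomial.C
      = ∑ j, (Polynomial.C ((Sum.elim (fun _ => (1 : ℝ)) (fun _ => -1)) (ε.symm j))
          * (X : ℝ[X]) ^ ((Sum.elim (fun oc => oc.1.elim e d) (fun _ => e)) (ε.symm j)))
        • (Matrix.vecMulVec
            ((Sum.elim (fun oc => fun i => (oc.1.elim S₀ S) i oc.2) (fun c => fun i => W i c)) (ε.symm j))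
            ((Sum.elim (fun oc => fun i => (oc.1.elim S₀ S) i oc.2) (fun c => fun i => W i c)) (ε.symm j))).map
          Polynomial.C := by
  refine Matrix.ext fun i i' => ?_
  have hL : (((X : ℝ[X]) ^ e) • J.map Polynomial.C + ∑ k, ((X : ℝ[X]) ^ d k) • (P k).map Polynomial.C) i i'
      = (X : ℝ[X]) ^ e * Polynomial.C (J i i') + ∑ k, (X : ℝ[X]) ^ d k * Polynomial.C (P k i i') := by
    simp only [Matrix.add_apply, Matrix.smul_apply, Matrix.map_apply, Matrix.sum_apply, smul_eq_mul]
  have hR : (∑ j, (Polynomial.C ((Sum.elim (fun _ => (1 : ℝ)) (fun _ => -1)) (ε.symm j))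
          * (X : ℝ[X]) ^ ((Sum.elim (fun oc => oc.1.elim e d) (fun _ => e)) (ε.symm j)))
        • (Matrix.vecMulVec
            ((Sum.elim (fun oc => fun i => (oc.1.elim S₀ S) i oc.2) (fun c => fun i => W i c)) (ε.symm j))
            ((Sum.elim (fun oc => fun i => (oc.1.elim S₀ S) i oc.2) (fun c => fun i => W i c)) (ε.symm j))).map
          Polynomial.C) i i'
      = ∑ x : (Option (Fin K) × Fin m) ⊕ Fin q,
          Polynomial.C ((Sum.elim (fun _ => (1 : ℝ)) (fun _ => -1)) x)
            * (X : ℝ[X]) ^ ((Sum.elim (fun oc => oc.1.elim e d) (fun _ => e)) x)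
            * Polynomial.C (((Sum.elim (fun oc => fun i => (oc.1.elim S₀ S) i oc.2) (fun c => fun i => W i c)) x) i
              * ((Sum.elim (fun oc => fun i => (oc.1.elim S₀ S) i oc.2) (fun c => fun i => W i c)) x) i') := by
    rw [Matrix.sum_apply]
    simp only [Matrix.smul_apply, Matrix.map_apply, Matrix.vecMulVec_apply, smul_eq_mul]
    exact Equiv.sum_comp ε.symm (fun x => Polynomial.C ((Sum.elim (fun _ => (1 : ℝ)) (fun _ => -1)) x)
      * (X : ℝ[X]) ^ ((Sum.elim (fun oc => oc.1.elim e d) (fun _ => e)) x)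
      * Polynomial.C (((Sum.elim (fun oc => fun i => (oc.1.elim S₀ S) i oc.2) (fun c => fun i => W i c)) x) i
        * ((Sum.elim (fun oc => fun i => (oc.1.elim S₀ S) i oc.2) (fun c => fun i => W i c)) x) i'))
  rw [hL, hR, Fintype.sum_sum_type, Fintype.sum_prod_type, Fintype.sum_option]
  simp only [Sum.elim_inl, Sum.elim_inr, Option.elim_none, Option.elim_some, map_one, one_mul]
  have h0 : ∑ c : Fin m, (X : ℝ[X]) ^ e * Polynomial.C (S₀ i c * S₀ i' c)
      = (X : ℝ[X]) ^ e * Polynomial.C ((J + W * Wᵀ) i i') := by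
    rw [← Finset.mul_sum, ← map_sum, ResolventDescartes.sum_col_mul_col, hS₀]
  have hk : ∀ k, ∑ c : Fin m, (X : ℝ[X]) ^ d k * Polynomial.C (S k i c * S k i' c)
      = (X : ℝ[X]) ^ d k * Polynomial.C (P k i i') := by
    intro k
    rw [← Finset.mul_sum, ← map_sum, ResolventDescartes.sum_col_mul_col, ← hS k]
  have hW : ∑ c : Fin q, Polynomial.C (-1 : ℝ) * (X : ℝ[X]) ^ e * Polynomial.C (W i c * W i' c)
      = -((X : ℝ[X]) ^ e * Polynomial.C ((W * Wᵀ) i i')) := by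
    rw [Matrix.mul_apply, map_sum, Finset.mul_sum, ← Finset.sum_neg_distrib]
    refine Finset.sum_congr rfl fun c _ => ?_
    rw [Matrix.transpose_apply, map_neg, map_one]; ring
  simp_rw [h0, hk]
  rw [hW, Matrix.add_apply, map_add]
  ring

/-! ### 2. The graded count -/

/-- The ODD-LEVEL exponents: `j·e + (m − j letter exponents)` for `j` odd, `j ≤ q`, `j ≤ m` (letters `none ↦ S₀` at `e`, `some k ↦ Pₖ`). -/
theorem card_oddImage_le (e : ℕ) (d : Fin K → ℕ) (m q : ℕ) :
    ((Finset.range (min q m + 1)).filter (fun j => Odd j)).sum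
        (fun j => ((Finset.univ : Finset (Sym (Option (Fin K)) (m - j))).image
          (fun s : Sym (Option (Fin K)) (m - j) => j * e + ((s : Multiset (Option (Fin K))).map (fun o => o.elim e d)).sum)).card)
      ≤ ((Finset.range (min q m + 1)).filter (fun j => Odd j)).sum (fun j => Nat.choose (K + m - j) K) := by
  refine Finset.sum_le_sum fun j hj => ?_
  have hjm : j ≤ m := by
    have := Finset.mem_range.mp (Finset.mem_filter.mp hj).1; omega
  calc _ ≤ (Finset.univ : Finset (Sym (Option (Fin K)) (m - j))).card := Finset.card_image_le
    _ = Nat.choose (K + m - j) K := by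
        rw [Finset.card_univ, Sym.card_sym_eq_choose, Fintype.card_option, Fintype.card_fin]
        rw [show K + 1 + (m - j) - 1 = K + (m - j) by omega, show K + m - j = K + (m - j) by omega]
        exact Nat.choose_symm_add.symm

/-- **The index-graded Descartes bound** (all `m, K, q`): a pivot pencil of index `≤ q` has
`Z₊ ≤ 2 · ∑_{j odd, j ≤ min q m} C(K + m − j, K)`. [folklore] -/
theorem pivotRootLawAt_indexGraded (m K q : ℕ) :
    PivotRootLawAt m K q (2 * ((Finset.range (min q m + 1)).filter (fun j => Odd j)).sum (fun j => Nat.choose (K + m - j) K)) := by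
  classical
  intro e d J P hJ hP hW
  obtain ⟨W, hW⟩ := hW
  obtain ⟨S₀, hS₀⟩ := ResolventDescartes.exists_eq_mul_transpose (J + W * Wᵀ) hW
  choose S hS using fun k => ResolventDescartes.exists_eq_mul_transpose (P k) (hP k)
  unfold pivotPosRoots
  set σ := (Option (Fin K) × Fin m) ⊕ Fin q with hσ
  set ε : σ ≃ Fin (Fintype.card σ) := Fintype.equivFin σ with hε
  set sgσ : σ → ℝ := Sum.elim (fun _ => (1 : ℝ)) (fun _ => -1) with hsg
  set exσ : σ → ℕ := Sum.elim (fun oc => oc.1.elim e d) (fun _ => e) with hex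
  rw [pencil_eq_gram e d J P W S₀ S hS₀ hS ε]
  -- the odd-level exponent set
  set T : Finset ℕ := ((Finset.range (min q m + 1)).filter (fun j => Odd j)).biUnion
      (fun j => (Finset.univ : Finset (Sym (Option (Fin K)) (m - j))).image
        (fun s : Sym (Option (Fin K)) (m - j) => j * e + ((s : Multiset (Option (Fin K))).map (fun o => o.elim e d)).sum)) with hT
  have hTcard : T.card ≤ ((Finset.range (min q m + 1)).filter (fun j => Odd j)).sum (fun j => Nat.choose (K + m - j) K) :=
    Finset.card_biUnion_le.trans (card_oddImage_le e d m q)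
  refine (TwoDescartes.card_posRoots_le_two_mul_card _ T fun n hn => ?_).trans (Nat.mul_le_mul_left 2 hTcard)
  -- a negative coefficient comes from a column selection with an ODD number of negative columns
  by_contra hnT
  refine absurd hn (not_lt.2 ?_)
  rw [GramExpansion.coeff_det_gramPencil]
  refine Finset.sum_nonneg fun t ht => ?_
  have htinj : Function.Injective t := (Finset.mem_filter.1 ht).2.injective
  split_ifs with hsum
  swap
  · exact le_rfl
  -- the set `A` of rows whose selected column is a negative column
  set A : Finset (Fin m) := Finset.univ.filter (fun a => ∃ c, ε.symm (t a) = Sum.inr c) with hA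
  have hsign : ∏ a, sgσ (ε.symm (t a)) = (-1 : ℝ) ^ A.card := by
    rw [← Finset.prod_filter_mul_prod_filter_not Finset.univ (fun a => ∃ c, ε.symm (t a) = Sum.inr c), ← hA]
    have h1 : ∏ a ∈ A, sgσ (ε.symm (t a)) = (-1 : ℝ) ^ A.card := by
      rw [← Finset.prod_const]
      refine Finset.prod_congr rfl fun a ha => ?_
      obtain ⟨c, hc⟩ := (Finset.mem_filter.mp (hA ▸ ha)).2
      rw [hc, hsg, Sum.elim_inr]
    have h2 : ∏ a ∈ Finset.univ.filter (fun a => ¬ ∃ c, ε.symm (t a) = Sum.inr c), sgσ (ε.symm (t a)) = 1 := by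
      refine Finset.prod_eq_one fun a ha => ?_
      have hno := (Finset.mem_filter.mp ha).2
      rcases hx : ε.symm (t a) with oc | c
      · rw [hsg, Sum.elim_inl]
      · exact absurd ⟨c, hx⟩ hno
    rw [h1, h2, mul_one]
  by_cases hpar : Even A.card
  · -- even number of negative columns: non-negative term
    change 0 ≤ (∏ a, sgσ (ε.symm (t a))) * _
    rw [hsign, hpar.neg_one_pow, one_mul]
    exact sq_nonneg _
  · -- odd: the exponent lies in `T`
    exfalso
    have hodd : Odd A.card := Nat.not_even_iff_odd.mp hpar
    -- letters of the other rows
    have hother : ∀ a, a ∉ A → ∃ oc : Option (Fin K) × Fin m, ε.symm (t a) = Sum.inl oc := by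
      intro a ha
      rcases hx : ε.symm (t a) with oc | c
      · exact ⟨oc, rfl⟩
      · exact absurd (Finset.mem_filter.mpr ⟨Finset.mem_univ _, ⟨c, hx⟩⟩) ha
    choose! oc hoc using hother
    set s : Multiset (Option (Fin K)) := (Finset.univ \ A).val.map (fun a => (oc a).1) with hs
    have hAq : A.card ≤ q := by
      -- the negative columns used by the rows of `A` are distinct
      rcases Nat.eq_zero_or_pos q with hq0 | hq0
      · subst hq0
        have : A = ∅ := by
          rw [Finset.eq_empty_iff_forall_notMem]
          intro a ha
          obtain ⟨c, _⟩ := (Finset.mem_filter.mp (hA ▸ ha)).2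
          exact Fin.elim0 c
        rw [this, Finset.card_empty]
      · have hinj : ∀ a b, ε.symm (t a) = ε.symm (t b) → a = b := fun a b h => htinj (ε.symm.injective h)
        let col : Fin m → Fin q := fun a => (ε.symm (t a)).elim (fun _ => ⟨0, hq0⟩) id
        have : A.card ≤ (Finset.univ : Finset (Fin q)).card := by
          refine Finset.card_le_card_of_injOn col (fun _ _ => Finset.mem_univ _) ?_
          intro a ha b hb hab
          obtain ⟨ca, hca⟩ := (Finset.mem_filter.mp (hA ▸ Finset.mem_coe.mp ha)).2
          obtain ⟨cb, hcb⟩ := (Finset.mem_filter.mp (hA ▸ Finset.mem_coe.mp hb)).2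
          have hc : ca = cb := by simpa [col, hca, hcb] using hab
          exact hinj a b (by rw [hca, hcb, hc])
        simpa using this
    have hscard : Multiset.card s = m - A.card := by
      rw [hs, Multiset.card_map, Finset.card_val, Finset.card_sdiff, Finset.inter_univ, Finset.card_univ, Fintype.card_fin]
    have hAm : A.card ≤ m := (Finset.card_le_univ A).trans (by rw [Fintype.card_fin])
    apply hnT
    rw [hT]
    refine Finset.mem_biUnion.mpr ⟨A.card, Finset.mem_filter.mpr ⟨Finset.mem_range.mpr ?_, hodd⟩, ?_⟩
    · have := Nat.le_min.mpr ⟨hAq, hAm⟩; omega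
    refine Finset.mem_image.mpr ⟨⟨s, hscard⟩, Finset.mem_univ _, ?_⟩
    -- the exponent: negative columns contribute `e` each, the others their letter exponents
    rw [hsum, ← Finset.sum_filter_add_sum_filter_not Finset.univ (fun a => ∃ c, ε.symm (t a) = Sum.inr c), ← hA]
    have hneg : ∑ a ∈ A, exσ (ε.symm (t a)) = A.card * e := by
      rw [Finset.sum_const_nat fun a ha => ?_]
      obtain ⟨c, hc⟩ := (Finset.mem_filter.mp (hA ▸ ha)).2
      rw [hc, hex, Sum.elim_inr]
    have hset : Finset.univ.filter (fun a => ¬ ∃ c, ε.symm (t a) = Sum.inr c) = Finset.univ \ A := by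
      ext a; simp [hA]
    have hpos : ∑ a ∈ Finset.univ.filter (fun a => ¬ ∃ c, ε.symm (t a) = Sum.inr c), exσ (ε.symm (t a))
        = (s.map fun o => o.elim e d).sum := by
      rw [hs, Multiset.map_map, Function.comp_def, ← Finset.sum_map_val, hset]
      refine Finset.sum_congr rfl fun a ha => ?_
      have ha' : a ∉ A := (Finset.mem_sdiff.mp ha).2
      rw [hoc a ha', hex, Sum.elim_inl]
    change (A.card * e + (s.map fun o => o.elim e d).sum) = _
    rw [hneg, hpos]

/-- **INDEX TWO IS FREE**: `PivotRootLawAt m K 2 (2·C(K+m−1, m−1))` — the budget of the index-one resolvent row. [folklore] -/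
theorem pivotRootLawAt_two_index (m K : ℕ) : PivotRootLawAt m K 2 (2 * Nat.choose (K + m - 1) (m - 1)) := by
  refine pivotRootLawAt_mono (pivotRootLawAt_indexGraded m K 2) (Nat.mul_le_mul_left 2 ?_)
  have hodd : ∀ f : ℕ → ℕ, ((Finset.range 3).filter (fun j => Odd j)).sum f = f 1 := by
    intro f
    rw [Finset.sum_filter, Finset.sum_range_succ, Finset.sum_range_succ, Finset.sum_range_succ, Finset.sum_range_zero]
    simp [Nat.odd_iff]
  rcases m with _ | m
  · simp [Finset.sum_filter, Nat.odd_iff]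
  rcases m with _ | m
  · -- m = 1: `min 2 1 = 1`, the only odd level is `j = 1`: `C(K, K) = 1 = C(K, 0)`
    rw [show min 2 1 + 1 = 2 by norm_num, Finset.sum_filter, Finset.sum_range_succ, Finset.sum_range_succ,
      Finset.sum_range_zero]
    simp [Nat.odd_iff]
  · rw [show min 2 (m + 2) + 1 = 3 by omega, hodd, show K + (m + 2) - 1 = K + (m + 1) by omega,
      show m + 2 - 1 = m + 1 by omega]
    exact Nat.choose_symm_add.le

end IndexGraded

end Summit.ValiantsHypothesis.ValiantsHypothesis.Theorems.LacunarySymmetroidMatrixDescartes.Pivot
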